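import Literature.MathematicalPhysics.KineticTheory.InfiniteChainGibbsStationarity
import Literature.MathematicalPhysics.KineticTheory.InfiniteChainVariationalCalculus
import Literature.MathematicalPhysics.KineticTheory.InfiniteChainCurrentMoments
import Literature.MathematicalPhysics.KineticTheory.InfiniteChainDynamicsCondB1
import Literature.MathematicalPhysics.KineticTheory.InfiniteChainTightRegular
import HarnessLib

/-!
# The thermal states of the pinned anharmonic chain are time invariant

Topic `Literature/MathematicalPhysics/KineticTheory`; theorems only (no definitions, no named facts).
Companion of `InfiniteChainGibbsStationarity.lean` (`IsChainGibbsMeasure.isTimeInvariant`: a DLR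
Gibbs state with integrable momenta and forces is time invariant in the generator sense of
Bernardin 2014, Def. 1) for the tree's chain `pinnedChain ω₂ lam β γ`
(`U(q) = ω₂ q²/2 + lam q⁴/4`, `V(r) = r²/2 + β r⁴/4`; `ω₂ > 0`, `lam, β ≥ 0`):

* `bmLocalEnergy_zero` — `W_{x,0} = p_x²/2 + U(q_x) + 1`;
* `HasSuperstabilityEstimate.exists_integral_abs_pow_add_le_pinnedChain` — under Buttà–Marchioro's
  superstability estimate (2.3) ALL SITE MOMENTS are finite, UNIFORMLY in the site:
  `∀ m ∃ C ∀ x, ∫ (|q_x|^m + |p_x|^m) dμ ≤ C` (the "translation-bounded" hypothesis shape of the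
  Fourier's-law routes), from `|q_x|, |p_x| ≤ K · W_{x,0}` and `W_{x,0}^m ∈ L¹` uniformly;
* `integrable_force_pinnedChain` — the (cubic) forces are integrable once `|q_x|, |q_x|³ ∈ L¹`;
* `isTimeInvariant_pinnedChain_of_hasSuperstabilityEstimate` — **every superstable DLR Gibbs state
  of the pinned chain is `IsTimeInvariant`**;
* `isTimeInvariant_pinnedChain_of_isShiftInvariant` — in particular **the shift-invariant Gibbs
  state** (the transfer-operator Markov state; `InfiniteChainTightRegular`) **is time invariant**:
  the regular thermal states of the routes `ParityLiouvilleSeed` / `LocalOhmBV` / `CurrentTiltQuench`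
  inhabit the hypothesis class "time-invariant, translation-bounded, regular" of their rigidity
  statements (`ZeroCurrentRigidity`, `LiouvilleForHeat`).

[cite: LanfordLebowitzLieb1977, §4 remark (i)] [cite: Bernardin2014, §1.1 Def. 1 footnote]
[cite: ButtaMarchioro2016, §2 eq. (2.3)]
-/

noncomputable section

open MeasureTheory Filter Topology Set
open scoped ENNReal

namespace Literature.MathematicalPhysics.KineticTheory.HeatConduction

namespace OscillatorChain

/-! ### Site moments of superstable states -/

/-- `W_{x,0}(σ) = p_x²/2 + U(q_x) + 1` (the one-site box has no bonds). [cite: ButtaMarchioro2016, §2 eq. (2.4)] -/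
theorem bmLocalEnergy_zero (P : OscillatorChain) (x : ℤ) (σ : ChainConfig) :
    P.bmLocalEnergy x 0 σ = (σ x).2 ^ 2 / 2 + P.U (σ x).1 + 1 := by
  simp [bmLocalEnergy]

/-- **Site bounds for the pinned chain**: `|q_x| ≤ (1 + 2/ω₂) W_{x,0}` and `|p_x| ≤ 3 W_{x,0}`
(`U(q) ≥ ω₂ q²/2`, `W ≥ 1`). [folklore] -/
theorem abs_le_mul_bmLocalEnergy_zero_pinnedChain {ω₂ lam : ℝ} (β γ : ℝ) (hω : 0 < ω₂)
    (hl : 0 ≤ lam) (x : ℤ) (σ : ChainConfig) :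
    |(σ x).1| ≤ (1 + 2 / ω₂) * (pinnedChain ω₂ lam β γ).bmLocalEnergy x 0 σ ∧
      |(σ x).2| ≤ 3 * (pinnedChain ω₂ lam β γ).bmLocalEnergy x 0 σ := by
  set q : ℝ := (σ x).1 with hq
  set p : ℝ := (σ x).2 with hp
  have hU : (pinnedChain ω₂ lam β γ).U q = ω₂ * q ^ 2 / 2 + lam * q ^ 4 / 4 := rfl
  have hW : (pinnedChain ω₂ lam β γ).bmLocalEnergy x 0 σ = p ^ 2 / 2 + (ω₂ * q ^ 2 / 2 + lam * q ^ 4 / 4) + 1 := by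
    rw [bmLocalEnergy_zero, ← hU]
  rw [hW]
  have hl4 : 0 ≤ lam * q ^ 4 / 4 := by positivity
  have hq2 : q ^ 2 ≤ 2 / ω₂ * (p ^ 2 / 2 + (ω₂ * q ^ 2 / 2 + lam * q ^ 4 / 4) + 1) := by
    have h1 : ω₂ * q ^ 2 / 2 ≤ p ^ 2 / 2 + (ω₂ * q ^ 2 / 2 + lam * q ^ 4 / 4) + 1 := by
      nlinarith [sq_nonneg p]
    calc q ^ 2 = 2 / ω₂ * (ω₂ * q ^ 2 / 2) := by field_simp
      _ ≤ 2 / ω₂ * (p ^ 2 / 2 + (ω₂ * q ^ 2 / 2 + lam * q ^ 4 / 4) + 1) :=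
          mul_le_mul_of_nonneg_left h1 (by positivity)
  have habs : ∀ u : ℝ, |u| ≤ 1 + u ^ 2 := fun u => by
    have h1 : 0 ≤ (|u| - 1) ^ 2 := sq_nonneg _
    have h2 : |u| ^ 2 = u ^ 2 := sq_abs u
    nlinarith [h1, h2, sq_nonneg u, abs_nonneg u]
  have hqa := habs q
  have hpa := habs p
  have hω' : 0 ≤ 2 / ω₂ := by positivity
  constructor
  · nlinarith [hqa, hq2, sq_nonneg p, sq_nonneg q, hl4, hω']
  · nlinarith [hpa, sq_nonneg p, sq_nonneg q, hl4, hω.le]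

/-- **All site moments of a superstable state of the pinned chain are finite, uniformly in the
site**: for `ω₂ > 0`, `lam, β ≥ 0`, a state obeying Buttà–Marchioro's superstability estimate (2.3)
has `∫ (|q_x|^m + |p_x|^m) dμ ≤ C_m` for all `x ∈ ℤ`. [cite: ButtaMarchioro2016, §2 eq. (2.3)] -/
theorem HasSuperstabilityEstimate.exists_integral_abs_pow_add_le_pinnedChain {ω₂ lam β : ℝ} (γ : ℝ)
    (hω : 0 < ω₂) (hl : 0 ≤ lam) (hβ : 0 ≤ β) {μ : Measure ChainConfig}
    (hss : (pinnedChain ω₂ lam β γ).HasSuperstabilityEstimate μ) (m : ℕ) :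
    ∃ C : ℝ, ∀ x : ℤ, Integrable (fun σ : ChainConfig => |(σ x).1| ^ m + |(σ x).2| ^ m) μ ∧
      ∫ σ, (|(σ x).1| ^ m + |(σ x).2| ^ m) ∂μ ≤ C := by
  have hU0 := pinnedChain_U_nonneg β γ hω.le hl
  have hV0 : ∀ r, 0 ≤ (pinnedChain ω₂ lam β γ).V r := fun r => by
    show (0 : ℝ) ≤ r ^ 2 / 2 + β * r ^ 4 / 4
    positivity
  have hVm : Measurable (pinnedChain ω₂ lam β γ).V := by
    show Measurable fun r : ℝ => r ^ 2 / 2 + β * r ^ 4 / 4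
    fun_prop
  obtain ⟨C, lam₀, -, -, h⟩ := hss.exists_integral_bmLocalEnergy_pow_le hU0 hV0
    (measurable_pinnedChain_U ω₂ lam β γ) hVm
  set K : ℝ := (1 + 2 / ω₂) ^ m + 3 ^ m with hK
  have hK0 : 0 ≤ K := by positivity
  refine ⟨K * ((m.factorial : ℝ) / lam₀ ^ m * Real.exp (C * (2 * ((0 : ℕ) : ℝ) + 1))), fun x => ?_⟩
  obtain ⟨hint, hle⟩ := h x 0 m
  have hpt : ∀ σ : ChainConfig, |(σ x).1| ^ m + |(σ x).2| ^ m ≤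
      K * (pinnedChain ω₂ lam β γ).bmLocalEnergy x 0 σ ^ m := fun σ => by
    obtain ⟨hq, hp⟩ := abs_le_mul_bmLocalEnergy_zero_pinnedChain β γ hω hl x σ
    have hqm := pow_le_pow_left₀ (abs_nonneg _) hq m
    have hpm := pow_le_pow_left₀ (abs_nonneg _) hp m
    rw [mul_pow] at hqm hpm
    rw [hK, add_mul]
    exact add_le_add hqm hpm
  have hmeas : Measurable fun σ : ChainConfig => |(σ x).1| ^ m + |(σ x).2| ^ m :=
    ((measurable_pi_apply x).fst.abs.pow_const m).add ((measurable_pi_apply x).snd.abs.pow_const m)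
  have hdom : Integrable (fun σ => K * (pinnedChain ω₂ lam β γ).bmLocalEnergy x 0 σ ^ m) μ :=
    hint.const_mul K
  have hintm : Integrable (fun σ : ChainConfig => |(σ x).1| ^ m + |(σ x).2| ^ m) μ := by
    refine hdom.mono' hmeas.aestronglyMeasurable (Eventually.of_forall fun σ => ?_)
    rw [Real.norm_of_nonneg (by positivity)]
    exact hpt σ
  refine ⟨hintm, ?_⟩
  calc ∫ σ, (|(σ x).1| ^ m + |(σ x).2| ^ m) ∂μ
      ≤ ∫ σ, K * (pinnedChain ω₂ lam β γ).bmLocalEnergy x 0 σ ^ m ∂μ := integral_mono hintm hdom hpt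
    _ = K * ∫ σ, (pinnedChain ω₂ lam β γ).bmLocalEnergy x 0 σ ^ m ∂μ := integral_const_mul _ _
    _ ≤ K * ((m.factorial : ℝ) / lam₀ ^ m * Real.exp (C * (2 * ((0 : ℕ) : ℝ) + 1))) :=
        mul_le_mul_of_nonneg_left hle hK0

/-- From the summed site moments to the separate ones. [folklore] -/
theorem integrable_abs_pow_of_add {μ : Measure ChainConfig} {m : ℕ} {x : ℤ}
    (h : Integrable (fun σ : ChainConfig => |(σ x).1| ^ m + |(σ x).2| ^ m) μ) :
    Integrable (fun σ : ChainConfig => |(σ x).1| ^ m) μ ∧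
      Integrable (fun σ : ChainConfig => |(σ x).2| ^ m) μ := by
  constructor
  · refine h.mono' ((measurable_pi_apply x).fst.abs.pow_const m).aestronglyMeasurable
      (Eventually.of_forall fun σ => ?_)
    rw [Real.norm_of_nonneg (by positivity)]
    have : 0 ≤ |(σ x).2| ^ m := by positivity
    linarith
  · refine h.mono' ((measurable_pi_apply x).snd.abs.pow_const m).aestronglyMeasurable
      (Eventually.of_forall fun σ => ?_)
    rw [Real.norm_of_nonneg (by positivity)]
    have : 0 ≤ |(σ x).1| ^ m := by positivity
    linarith

/-! ### Integrability of the forces of the pinned chain -/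

/-- `|a - b|³ ≤ 4 (|a|³ + |b|³)` (`4(u³+v³) - (u+v)³ = 3(u+v)(u-v)²`). [folklore] -/
theorem abs_sub_pow_three_le (a b : ℝ) : |a - b| ^ 3 ≤ 4 * (|a| ^ 3 + |b| ^ 3) := by
  have h : |a - b| ^ 3 ≤ (|a| + |b|) ^ 3 := pow_le_pow_left₀ (abs_nonneg _) (abs_sub a b) 3
  nlinarith [h, mul_nonneg (add_nonneg (abs_nonneg a) (abs_nonneg b)) (sq_nonneg (|a| - |b|))]

/-- `|u + c u³| ≤ |u| + |c| |u|³`. [folklore] -/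
theorem abs_add_mul_pow_three_le (c u : ℝ) : |u + c * u ^ 3| ≤ |u| + |c| * |u| ^ 3 := by
  calc |u + c * u ^ 3| ≤ |u| + |c * u ^ 3| := abs_add_le _ _
    _ = |u| + |c| * |u| ^ 3 := by rw [abs_mul, abs_pow]

/-- `|(a - b) + c (a - b)³| ≤ (|a| + |b|) + |c| · 4 (|a|³ + |b|³)`. [folklore] -/
theorem abs_pinnedBondForce_le (c a b : ℝ) :
    |(a - b) + c * (a - b) ^ 3| ≤ (|a| + |b|) + |c| * (4 * (|a| ^ 3 + |b| ^ 3)) :=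
  (abs_add_mul_pow_three_le c (a - b)).trans
    (add_le_add (abs_sub a b) (mul_le_mul_of_nonneg_left (abs_sub_pow_three_le a b) (abs_nonneg c)))

/-- **The forces of the pinned chain are integrable** in any state with `|q_x|, |q_x|³ ∈ L¹` for all
sites. [folklore] -/
theorem integrable_force_pinnedChain (ω₂ lam β γ : ℝ) {μ : Measure ChainConfig}
    (h1 : ∀ x : ℤ, Integrable (fun σ : ChainConfig => |(σ x).1|) μ)
    (h3 : ∀ x : ℤ, Integrable (fun σ : ChainConfig => |(σ x).1| ^ 3) μ) (x : ℤ) :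
    Integrable (fun σ : ChainConfig => (pinnedChain ω₂ lam β γ).force σ x) μ := by
  have hG : Integrable (fun σ : ChainConfig =>
      (|ω₂| * |(σ x).1| + |lam| * |(σ x).1| ^ 3) +
        ((|(σ (x + 1)).1| + |(σ x).1|) + |β| * (4 * (|(σ (x + 1)).1| ^ 3 + |(σ x).1| ^ 3))) +
        ((|(σ x).1| + |(σ (x - 1)).1|) + |β| * (4 * (|(σ x).1| ^ 3 + |(σ (x - 1)).1| ^ 3)))) μ :=
    ((((h1 x).const_mul |ω₂|).add ((h3 x).const_mul |lam|)).add
      (((h1 (x + 1)).add (h1 x)).add ((((h3 (x + 1)).add (h3 x)).const_mul 4).const_mul |β|))).add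
      (((h1 x).add (h1 (x - 1))).add ((((h3 x).add (h3 (x - 1))).const_mul 4).const_mul |β|))
  refine hG.mono' (measurable_force _ x).aestronglyMeasurable (Eventually.of_forall fun σ => ?_)
  -- `F_x = -(ω₂ q_x + lam q_x³) + (r_x + β r_x³) - (r_{x-1} + β r_{x-1}³)`, `r_x = q_{x+1} - q_x`
  have hF : (pinnedChain ω₂ lam β γ).force σ x =
      -(ω₂ * (σ x).1 + lam * (σ x).1 ^ 3) +
        (((σ (x + 1)).1 - (σ x).1) + β * ((σ (x + 1)).1 - (σ x).1) ^ 3) -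
        (((σ x).1 - (σ (x - 1)).1) + β * ((σ x).1 - (σ (x - 1)).1) ^ 3) := by
    simp only [force_eq, pinnedChain_deriv_U_eq, pinnedChain_deriv_V_eq]
  rw [Real.norm_eq_abs, hF]
  have hA : |-(ω₂ * (σ x).1 + lam * (σ x).1 ^ 3)| ≤ |ω₂| * |(σ x).1| + |lam| * |(σ x).1| ^ 3 := by
    rw [abs_neg]
    calc |ω₂ * (σ x).1 + lam * (σ x).1 ^ 3| ≤ |ω₂ * (σ x).1| + |lam * (σ x).1 ^ 3| := abs_add_le _ _
      _ = |ω₂| * |(σ x).1| + |lam| * |(σ x).1| ^ 3 := by rw [abs_mul, abs_mul, abs_pow]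
  have hB := abs_pinnedBondForce_le β (σ (x + 1)).1 (σ x).1
  have hC := abs_pinnedBondForce_le β (σ x).1 (σ (x - 1)).1
  refine (abs_sub _ _).trans ((add_le_add ((abs_add_le _ _).trans (add_le_add hA hB)) hC).trans ?_)
  exact le_rfl

/-! ### Time invariance of the thermal states of the pinned chain -/

/-- `U` of the pinned chain is `C²` (a polynomial). [folklore] -/
theorem contDiff_two_U_pinnedChain (ω₂ lam β γ : ℝ) : ContDiff ℝ 2 (pinnedChain ω₂ lam β γ).U := by
  show ContDiff ℝ 2 fun q : ℝ => ω₂ * q ^ 2 / 2 + lam * q ^ 4 / 4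
  fun_prop

/-- `V` of the pinned chain is `C²` (a polynomial). [folklore] -/
theorem contDiff_two_V_pinnedChain (ω₂ lam β γ : ℝ) : ContDiff ℝ 2 (pinnedChain ω₂ lam β γ).V := by
  show ContDiff ℝ 2 fun r : ℝ => r ^ 2 / 2 + β * r ^ 4 / 4
  fun_prop

/-- **Every superstable DLR Gibbs state of the pinned anharmonic chain is time invariant** in the
generator sense (`IsTimeInvariant`: `∫ 𝒜f dμ = 0`, `𝒜f ∈ L¹(μ)`, for all `f ∈ C₀¹`), for `ω₂ > 0`,
`lam, β ≥ 0`, any `γ` and any temperature. [cite: LanfordLebowitzLieb1977, §4 remark (i)] -/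
theorem isTimeInvariant_pinnedChain_of_hasSuperstabilityEstimate {ω₂ lam β : ℝ} (γ : ℝ)
    (hω : 0 < ω₂) (hl : 0 ≤ lam) (hβ : 0 ≤ β) {T : ℝ} {μ : Measure ChainConfig}
    (hμ : (pinnedChain ω₂ lam β γ).IsChainGibbsMeasure T μ)
    (hss : (pinnedChain ω₂ lam β γ).HasSuperstabilityEstimate μ) :
    IsTimeInvariant (pinnedChain ω₂ lam β γ) μ := by
  have hmom : ∀ (m : ℕ) (x : ℤ), Integrable (fun σ : ChainConfig => |(σ x).1| ^ m) μ ∧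
      Integrable (fun σ : ChainConfig => |(σ x).2| ^ m) μ := fun m x => by
    obtain ⟨C, hC⟩ := hss.exists_integral_abs_pow_add_le_pinnedChain γ hω hl hβ m
    exact integrable_abs_pow_of_add (hC x).1
  have h1 : ∀ x : ℤ, Integrable (fun σ : ChainConfig => |(σ x).1|) μ := fun x => by
    simpa using (hmom 1 x).1
  have h3 : ∀ x : ℤ, Integrable (fun σ : ChainConfig => |(σ x).1| ^ 3) μ := fun x => (hmom 3 x).1
  have hp : ∀ x : ℤ, Integrable (fun σ : ChainConfig => (σ x).2) μ := fun x => by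
    have h := (hmom 1 x).2
    refine h.mono' (measurable_pi_apply x).snd.aestronglyMeasurable
      (Eventually.of_forall fun σ => ?_)
    simp [Real.norm_eq_abs]
  exact hμ.isTimeInvariant (contDiff_two_U_pinnedChain ω₂ lam β γ)
    (contDiff_two_V_pinnedChain ω₂ lam β γ) (condB1_pinnedChain hω.le hl hβ γ) hp
    (integrable_force_pinnedChain ω₂ lam β γ h1 h3)

/-- **The shift-invariant Gibbs state of the pinned anharmonic chain is time invariant**: for
`ω₂ > 0`, `lam, β ≥ 0`, `T > 0`, a translation-invariant DLR Gibbs state of `pinnedChain ω₂ lam β γ`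
(which is the transfer-operator Markov state and obeys BM (2.3),
`isShiftInvariant_and_hasSuperstabilityEstimate_of_tight_pinnedChain`) satisfies `IsTimeInvariant`.
[cite: LanfordLebowitzLieb1977, §4 remark (i)] -/
theorem isTimeInvariant_pinnedChain_of_isShiftInvariant {ω₂ lam β : ℝ} (γ : ℝ)
    (hω : 0 < ω₂) (hl : 0 ≤ lam) (hβ : 0 ≤ β) {T : ℝ} (hT : 0 < T) {μ : Measure ChainConfig}
    (hμ : (pinnedChain ω₂ lam β γ).IsChainGibbsMeasure T μ) (hS : IsShiftInvariant μ) :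
    IsTimeInvariant (pinnedChain ω₂ lam β γ) μ := by
  haveI : IsProbabilityMeasure μ := hμ.isProbabilityMeasure
  exact isTimeInvariant_pinnedChain_of_hasSuperstabilityEstimate γ hω hl hβ hμ
    (isShiftInvariant_and_hasSuperstabilityEstimate_of_tight_pinnedChain γ hω hl hβ hT hμ
      (oneSiteTight_of_isShiftInvariant hS)).2

/-- The site moments of the shift-invariant Gibbs state of the pinned chain are finite, uniformly
in the site (translation-boundedness of the thermal state). [folklore] -/
theorem exists_integral_abs_pow_add_le_pinnedChain_of_isShiftInvariant {ω₂ lam β : ℝ} (γ : ℝ)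
    (hω : 0 < ω₂) (hl : 0 ≤ lam) (hβ : 0 ≤ β) {T : ℝ} (hT : 0 < T) {μ : Measure ChainConfig}
    (hμ : (pinnedChain ω₂ lam β γ).IsChainGibbsMeasure T μ) (hS : IsShiftInvariant μ) (m : ℕ) :
    ∃ C : ℝ, ∀ x : ℤ, Integrable (fun σ : ChainConfig => |(σ x).1| ^ m + |(σ x).2| ^ m) μ ∧
      ∫ σ, (|(σ x).1| ^ m + |(σ x).2| ^ m) ∂μ ≤ C := by
  haveI : IsProbabilityMeasure μ := hμ.isProbabilityMeasure
  exact (isShiftInvariant_and_hasSuperstabilityEstimate_of_tight_pinnedChain γ hω hl hβ hT hμ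
    (oneSiteTight_of_isShiftInvariant hS)).2.exists_integral_abs_pow_add_le_pinnedChain γ hω hl hβ m

end OscillatorChain

end Literature.MathematicalPhysics.KineticTheory.HeatConduction

end
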